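import Summits.KontsevichZagierPeriods.KontsevichZagierPeriods.Theorems.RootDecompRationalCubeDichotomyNashMultiGenP10

/-! # `RootDecompRationalCubeDichotomyNashMultiGenP11` — part 11/16 of the mechanical ≤385-line split of `NashEtaleMultiGen.lean`
(split by the decomp-kz census seat for landing; mathematics unchanged; part 11 continues part 10). -/

open Set MvPolynomial Filter Topology
open Literature.NumberTheory.Transcendental (IsSemialgebraicFunOn)
open Literature.ModelTheory.ExponentialFields (IsSemialgebraic isSemialgebraic_setOf_eval_pos
  isSemialgebraic_setOf_eval_ne_zero)

namespace Summit.KontsevichZagierPeriods.RootDecompRationalCubeDichotomy.Rung29430.MultiGen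
open Summit.KontsevichZagierPeriods.KontsevichZagierPeriods.Theses.RootDecompRationalCubeDichotomy
  (NashEtaleCover NashEtaleLocal PiRationalisation)
open Summit.KontsevichZagierPeriods.RootDecompRationalCubeDichotomy.Rung29430.NashEtaleLocalGlue
  (local_of_simple nashEtaleCover_of_nashEtaleLocal nashEtaleLocal_zero)
open Summit.KontsevichZagierPeriods.RootDecompRationalCubeDichotomy.Rung29430.NashEtaleLocalOne
  (analyticOnNhd_aeval_snoc)
open Summit.KontsevichZagierPeriods.RootDecompRationalCubeDichotomy.RungEtale.Etale
  (piRationalisation_of_nashEtaleCover)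

noncomputable section

section OriginData
open Literature.NumberTheory.Transcendental Literature.ModelTheory.ExponentialFields

/-- Auxiliary step `spread_C`. [bookkeeping] -/
@[simp] theorem spread_C {m d k : ℕ} (a : PolyRing m) :
    spread m d k (C a) = MvPolynomial.rename (ιc m d k) a := MvPolynomial.aevalTower_C _ _ _

/-- Auxiliary step `spread_X`. [bookkeeping] -/
@[simp] theorem spread_X {m d k : ℕ} (l : Fin (d + k)) :
    spread m d k (X l) = X (ιv m d k l) := MvPolynomial.aevalTower_X _ _ _

/-- Evaluation of a spread polynomial: coefficients at `x ∘ ιc`, variables at `x ∘ ιv`. -/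
theorem aeval_spread {m d k : ℕ} (x : Fin (m + d + k) → ℝ) (P : MvPolynomial (Fin (d + k)) (PolyRing m)) :
    MvPolynomial.aeval x (spread m d k P) =
      MvPolynomial.eval₂ (MvPolynomial.aeval (fun i => x (ιc m d k i)) : PolyRing m →ₐ[ℚ] ℝ).toRingHom
        (fun l => x (ιv m d k l)) P := by
  induction P using MvPolynomial.induction_on with
  | C a =>
    simp [MvPolynomial.aeval_rename, Function.comp_def]
  | add p q hp hq => simp only [map_add, MvPolynomial.eval₂_add, hp, hq]
  | mul_X p l hp =>
    rw [map_mul, map_mul, MvPolynomial.eval₂_mul, hp, spread_X, MvPolynomial.aeval_X,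
      MvPolynomial.eval₂_X]

/-- `∂/∂y_j` commutes with spreading. -/
theorem pderiv_spread {m d k : ℕ} (j : Fin k) (P : MvPolynomial (Fin (d + k)) (PolyRing m)) :
    pderiv (Fin.natAdd (m + d) j) (spread m d k P) = spread m d k (pderiv (Fin.natAdd d j) P) := by
  classical
  induction P using MvPolynomial.induction_on with
  | C a =>
    rw [spread_C, MvPolynomial.pderiv_C, map_zero]
    exact pderiv_rename_eq_zero _ _ (fun i => ιc_ne_natAdd i j) a
  | add p q hp hq => simp only [map_add, hp, hq]
  | mul_X p l hp =>
    rw [map_mul, MvPolynomial.pderiv_mul, MvPolynomial.pderiv_mul, map_add, map_mul, map_mul, hp,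
      spread_X]
    congr 1
    rw [MvPolynomial.pderiv_X, MvPolynomial.pderiv_X]
    simp only [Pi.single_apply, ιv_eq_natAdd_iff]
    split_ifs <;> simp

/-- On the slice `(s₀, t, y)` the spread polynomial evaluates like the `ℚ[s]`-polynomial with
`s ↦ s₀`. -/
theorem aeval_spread_append {m d k : ℕ} (s₀ : Fin m → ℝ) (t : Fin d → ℝ) (y : Fin k → ℝ)
    (P : MvPolynomial (Fin (d + k)) (PolyRing m)) :
    letI := evalAlg s₀
    MvPolynomial.aeval (Fin.append (Fin.append s₀ t) y : Fin (m + d + k) → ℝ) (spread m d k P) =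
      MvPolynomial.aeval (Fin.append t y : Fin (d + k) → ℝ) P := by
  letI := evalAlg s₀
  rw [aeval_spread]
  have h1 : (fun i => (Fin.append (Fin.append s₀ t) y : Fin (m + d + k) → ℝ) (ιc m d k i)) = s₀ :=
    funext fun i => apply_ιc s₀ t y i
  rw [h1, apply_ιv, MvPolynomial.aeval_def]
  rfl

end OriginData

/-! ### §6.4  ASSEMBLY (PROVED): piece M at product points `(s₀, 0)` from `OriginNash d` -/

section SpreadAssembly

open Literature.NumberTheory.Transcendental Literature.ModelTheory.ExponentialFields

/-- **SLICE point data** (the residual in pure `ℚ`-terms): for the slice germ `G(t) = g(s₀, t)` of a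
`ℚ`-Nash `g` at a product point `(s₀, 0)`, `ℚ`-polynomials `F♯, A♯, B♯ ∈ ℚ[s, t, y]` and a REAL
point `y₀`, with `F♯(s₀, 0, y₀) = 0`, `det ∂F♯/∂y (s₀, 0, y₀) ≠ 0` (étale in `y` ONLY, at ONE point),
`B♯ ≠ 0` there, and `G(t) = A♯/B♯(s₀, t, u t)` near `t = 0` along every analytic solution `u(t)` of
`F♯(s₀, t, u) = 0` through `y₀`.  Only the SLICE has to be identified — the generic directions `s`
are free (§6, `exists_multiGenData_of_slicePointData`). -/
def SlicePointData (m d : ℕ) (s₀ : Fin m → ℝ) (G : (Fin d → ℝ) → ℝ) : Prop :=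
  ∃ (k : ℕ) (y₀ : Fin k → ℝ) (F : Fin k → MvPolynomial (Fin (m + d + k)) ℚ)
    (A B : MvPolynomial (Fin (m + d + k)) ℚ),
    (∀ i, MvPolynomial.aeval (Fin.append (Fin.append s₀ (0 : Fin d → ℝ)) y₀ : Fin (m + d + k) → ℝ)
      (F i) = 0) ∧
    (Matrix.of fun i j : Fin k =>
      MvPolynomial.aeval (Fin.append (Fin.append s₀ (0 : Fin d → ℝ)) y₀ : Fin (m + d + k) → ℝ)
        (pderiv (Fin.natAdd (m + d) j) (F i))).det ≠ 0 ∧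
    MvPolynomial.aeval (Fin.append (Fin.append s₀ (0 : Fin d → ℝ)) y₀ : Fin (m + d + k) → ℝ) B ≠ 0 ∧
    ∀ (V : Set (Fin d → ℝ)) (u : Fin k → (Fin d → ℝ) → ℝ), IsOpen V → (0 : Fin d → ℝ) ∈ V →
      (∀ j, u j 0 = y₀ j) → (∀ j, AnalyticOnNhd ℝ (u j) V) →
      (∀ t ∈ V, ∀ i, MvPolynomial.aeval
        (Fin.append (Fin.append s₀ t) (fun j => u j t) : Fin (m + d + k) → ℝ) (F i) = 0) →
      ∃ W ⊆ V, IsOpen W ∧ (0 : Fin d → ℝ) ∈ W ∧ ∀ t ∈ W,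
        G t = MvPolynomial.aeval (Fin.append (Fin.append s₀ t) (fun j => u j t) : Fin (m + d + k) → ℝ) A /
          MvPolynomial.aeval (Fin.append (Fin.append s₀ t) (fun j => u j t) : Fin (m + d + k) → ℝ) B

/-- **The residual in SLICE form** (pure `ℚ`; what the spreading-out assembly actually consumes):
at every product point `(s₀, 0)` with `s₀` algebraically independent over `ℚ`, the slice germ of every
`ℚ`-Nash `g` has slice point data. -/
def SliceNash (d : ℕ) : Prop :=
  ∀ (m : ℕ) (s₀ : Fin m → ℝ), AlgebraicIndependent ℚ s₀ →
    ∀ (g : (Fin (m + d) → ℝ) → ℝ) (U : Set (Fin (m + d) → ℝ)), IsOpen U →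
      (Fin.append s₀ (0 : Fin d → ℝ) : Fin (m + d) → ℝ) ∈ U → IsSemialgebraicFunOn ℚ U g →
      AnalyticOnNhd ℝ g U → SlicePointData m d s₀ (fun t => g (Fin.append s₀ t))

/-- `K`-point data of the slice germ over `K = ℚ[s₀]` SPREAD to slice point data over `ℚ`. -/
theorem slicePointData_of_originPointData {m d : ℕ} (s₀ : Fin m → ℝ) {G : (Fin d → ℝ) → ℝ}
    (h : letI := evalAlg s₀; OriginPointData (PolyRing m) d G) : SlicePointData m d s₀ G := by
  classical
  letI := evalAlg s₀
  obtain ⟨k, y₀, F, A, B, hF0, hJ0, hB0, hGid⟩ := h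
  refine ⟨k, y₀, fun i => spread m d k (F i), spread m d k A, spread m d k B, ?_, ?_, ?_, ?_⟩
  · intro i
    rw [aeval_spread_append]
    exact hF0 i
  · have : (Matrix.of fun i j : Fin k =>
        MvPolynomial.aeval (Fin.append (Fin.append s₀ (0 : Fin d → ℝ)) y₀ : Fin (m + d + k) → ℝ)
          (pderiv (Fin.natAdd (m + d) j) (spread m d k (F i)))) =
        Matrix.of fun i j : Fin k =>
          MvPolynomial.aeval (Fin.append (0 : Fin d → ℝ) y₀) (pderiv (Fin.natAdd d j) (F i)) := by
      ext i j
      simp only [Matrix.of_apply, pderiv_spread, aeval_spread_append]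
    rw [this]
    exact hJ0
  · rw [aeval_spread_append]
    exact hB0
  · intro V u hV h0 hu0 huan hFu
    obtain ⟨W, hWV, hWo, h0W, hW⟩ := hGid V u hV h0 hu0 huan (fun t ht i => by
      have := hFu t ht i
      rwa [aeval_spread_append] at this)
    refine ⟨W, hWV, hWo, h0W, fun t ht => ?_⟩
    rw [aeval_spread_append, aeval_spread_append]
    exact hW t ht

/-- `OriginNash d` implies the slice form (slice germs are `ℚ[s₀]`-Nash: `isSemialgebraicFunOn_slice`). -/
theorem sliceNash_of_originNash {d : ℕ} (hO : OriginNash d) : SliceNash d := by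
  classical
  intro m s₀ hind g U hU hy₀ hsa han
  letI := evalAlg s₀
  have hap : Continuous (fun t : Fin d → ℝ => (Fin.append s₀ t : Fin (m + d) → ℝ)) :=
    continuous_append_right s₀
  have hU'o : IsOpen ((fun t : Fin d → ℝ => (Fin.append s₀ t : Fin (m + d) → ℝ)) ⁻¹' U) :=
    hU.preimage hap
  have hGsa : IsSemialgebraicFunOn (PolyRing m)
      ((fun t : Fin d → ℝ => (Fin.append s₀ t : Fin (m + d) → ℝ)) ⁻¹' U) (fun t => g (Fin.append s₀ t)) :=
    isSemialgebraicFunOn_slice (K := PolyRing m) (fun i => (X i : PolyRing m)) s₀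
      (fun i => by
        show ((MvPolynomial.aeval s₀ : PolyRing m →ₐ[ℚ] ℝ).toRingHom) (X i) = s₀ i
        simp)
      hsa
  have hGan : AnalyticOnNhd ℝ (fun t => g (Fin.append s₀ t))
      ((fun t : Fin d → ℝ => (Fin.append s₀ t : Fin (m + d) → ℝ)) ⁻¹' U) :=
    fun t ht => (han _ ht).comp (analyticAt_append_right s₀ t)
  exact slicePointData_of_originPointData s₀ (hO (PolyRing m) _ _ hU'o hy₀ hGsa hGan)

/-- **Spreading out (assembly), from SLICE point data.**  At a product point `(s₀, 0)` with `s₀`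
algebraically independent over `ℚ`: the `ℚ`-Nash implicit functions `u` of the slice system `F♯`
(§4e) restrict on the slice to an analytic solution through `y₀`, so `g = A♯/B♯(x, u x)` ON THE
SLICE by the point-data clause, hence NEAR `(s₀, 0)` by the generic identity principle
`eventually_eq_zero_of_slice`. -/
theorem exists_multiGenData_of_slicePointData {m d : ℕ} {s₀ : Fin m → ℝ}
    (hind : AlgebraicIndependent ℚ s₀) {g : (Fin (m + d) → ℝ) → ℝ} {U : Set (Fin (m + d) → ℝ)}
    (hU : IsOpen U) (hy₀ : (Fin.append s₀ (0 : Fin d → ℝ) : Fin (m + d) → ℝ) ∈ U)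
    (hsa : IsSemialgebraicFunOn ℚ U g) (han : AnalyticOnNhd ℝ g U)
    (hS : SlicePointData m d s₀ (fun t => g (Fin.append s₀ t))) :
    ∃ k, MultiGenData (m + d) k g (Fin.append s₀ (0 : Fin d → ℝ)) := by
  classical
  obtain ⟨a, b, hyS, hSU⟩ := exists_ratBox_subset hU hy₀
  have hap : Continuous (fun t : Fin d → ℝ => (Fin.append s₀ t : Fin (m + d) → ℝ)) :=
    continuous_append_right s₀
  obtain ⟨k, y₀, F, A, B, hF0, hJ0, hB0, hGid⟩ := hS
  obtain ⟨V, u, hVo, hy₀V, hu₀, husa, huan, hFu⟩ :=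
    NashImplicit.exists_nash_implicit (F) (Fin.append s₀ (0 : Fin d → ℝ))
      y₀ hF0 hJ0
  have hpt : (Fin.append (Fin.append s₀ (0 : Fin d → ℝ)) fun j => u j (Fin.append s₀ 0) :
      Fin (m + d + k) → ℝ) = Fin.append (Fin.append s₀ (0 : Fin d → ℝ)) y₀ := by
    congr 1
    funext j
    exact hu₀ j
  have hptc : ∀ x ∈ V, ∀ r : Fin (m + d + k),
      AnalyticAt ℝ (fun x : Fin (m + d) → ℝ => (Fin.append x (fun j => u j x) : Fin (m + d + k) → ℝ) r) x := by
    intro x hx r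
    induction r using Fin.addCases with
    | left i =>
      simp only [Fin.append_left]
      exact (ContinuousLinearMap.proj (R := ℝ) (φ := fun _ : Fin (m + d) => ℝ) i).analyticAt x
    | right j =>
      simp only [Fin.append_right]
      exact huan j x hx
  -- where `B♯(x, u x) ≠ 0`
  have hBfc : ContinuousOn (fun x : Fin (m + d) → ℝ =>
      MvPolynomial.aeval (Fin.append x (fun j => u j x) : Fin (m + d + k) → ℝ) B) V :=
    fun x hx => (AnalyticAt.aeval_mvPolynomial (hptc x hx) _).continuousAt.continuousWithinAt
  have hO₁ : IsOpen (V ∩ (fun x : Fin (m + d) → ℝ =>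
      MvPolynomial.aeval (Fin.append x (fun j => u j x) : Fin (m + d + k) → ℝ) B) ⁻¹' {0}ᶜ) :=
    hBfc.isOpen_inter_preimage hVo isOpen_compl_singleton
  have hy₀O₁ : (Fin.append s₀ (0 : Fin d → ℝ) : Fin (m + d) → ℝ) ∈ V ∩ (fun x : Fin (m + d) → ℝ =>
      MvPolynomial.aeval (Fin.append x (fun j => u j x) : Fin (m + d + k) → ℝ) B) ⁻¹' {0}ᶜ := by
    refine ⟨hy₀V, ?_⟩
    rw [Set.mem_preimage, Set.mem_compl_singleton_iff, hpt]
    exact hB0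
  obtain ⟨a₁, b₁, hy₁, hB₁sub⟩ := exists_ratBox_subset (hO₁.inter (isOpen_ratBox a b)) ⟨hy₀O₁, hyS⟩
  have hV₁ : ratBox a₁ b₁ ⊆ V := fun x hx => (hB₁sub hx).1.1
  have hB₁ : ∀ x ∈ ratBox a₁ b₁,
      MvPolynomial.aeval (Fin.append x (fun j => u j x) : Fin (m + d + k) → ℝ) B ≠ 0 :=
    fun x hx => by
      have := (hB₁sub hx).1.2
      rwa [Set.mem_preimage, Set.mem_compl_singleton_iff] at this
  have hS₁ : ratBox a₁ b₁ ⊆ ratBox a b := fun x hx => (hB₁sub hx).2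
  -- `δ := g − A♯/B♯(x, u x)` is `ℚ`-Nash on the box
  let gt : (Fin (m + d) → ℝ) → ℝ := fun x =>
    MvPolynomial.aeval (Fin.append x (fun j => u j x) : Fin (m + d + k) → ℝ) A /
      MvPolynomial.aeval (Fin.append x (fun j => u j x) : Fin (m + d + k) → ℝ) B
  have hsa₁ : IsSemialgebraic ℚ (ratBox a₁ b₁) := isSemialgebraic_ratBox a₁ b₁
  have hmap : IsSemialgebraicMapOn ℚ (ratBox a₁ b₁)
      (fun x : Fin (m + d) → ℝ => (Fin.append x (fun j => u j x) : Fin (m + d + k) → ℝ)) := by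
    refine IsSemialgebraicMapOn.of_forall hsa₁ fun r => ?_
    induction r using Fin.addCases with
    | left i =>
      exact (isSemialgebraicFunOn_aeval hsa₁ (X i : MvPolynomial (Fin (m + d)) ℚ)).congr
        fun y _ => by simp
    | right j => exact ((husa j).mono hV₁ hsa₁).congr fun y _ => by simp
  have hgtsa : IsSemialgebraicFunOn ℚ (ratBox a₁ b₁) gt := by
    have ht : IsSemialgebraic ℚ
        {z : Fin (m + d + k) → ℝ | MvPolynomial.aeval z B ≠ 0} :=
      isSemialgebraic_setOf_eval_ne_zero _
    have hq := isSemialgebraicFunOn_aeval_div_aeval (k := ℚ) ht A B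
      (fun z hz => hz)
    exact IsSemialgebraicFunOn.comp_isSemialgebraicMapOn_holds hq hmap (fun x hx => hB₁ x hx)
  have hδsa : IsSemialgebraicFunOn ℚ (ratBox a₁ b₁) (g - gt) :=
    IsSemialgebraicFunOn.sub_holds (hsa.mono (fun x hx => hSU (hS₁ hx)) hsa₁) hgtsa
  have hδan : AnalyticOnNhd ℝ (g - gt) (ratBox a₁ b₁) := by
    intro x hx
    have hA := AnalyticAt.aeval_mvPolynomial (hptc x (hV₁ hx)) A
    have hB := AnalyticAt.aeval_mvPolynomial (hptc x (hV₁ hx)) B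
    exact (han x (hSU (hS₁ hx))).sub (hA.div hB (hB₁ x hx))
  -- the SLICE identity, from the point-data clause applied to `u_s(t) := u(s₀, t)`
  have hslice : ∀ᶠ t in 𝓝 (0 : Fin d → ℝ), (g - gt) (Fin.append s₀ t) = 0 := by
    have hVs : IsOpen ((fun t : Fin d → ℝ => (Fin.append s₀ t : Fin (m + d) → ℝ)) ⁻¹' ratBox a₁ b₁) :=
      (isOpen_ratBox a₁ b₁).preimage hap
    obtain ⟨W, -, hWo, h0W, hW⟩ := hGid
      ((fun t : Fin d → ℝ => (Fin.append s₀ t : Fin (m + d) → ℝ)) ⁻¹' ratBox a₁ b₁)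
      (fun j t => u j (Fin.append s₀ t)) hVs hy₁ (fun j => hu₀ j)
      (fun j t ht => (huan j _ (hV₁ ht)).comp (analyticAt_append_right s₀ t))
      (fun t ht i => hFu (Fin.append s₀ t) (hV₁ ht) i)
    filter_upwards [hWo.mem_nhds h0W] with t ht
    have h1 := hW t ht
    rw [Pi.sub_apply, sub_eq_zero]
    exact h1
  -- the generic identity principle: `δ = 0` NEAR `y₀`
  have hδ := eventually_eq_zero_of_slice hind (isOpen_ratBox a₁ b₁) hy₁ hδsa hδan hslice
  obtain ⟨O, hOsub, hOo, hy₀O⟩ := mem_nhds_iff.mp hδ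
  obtain ⟨a₂, b₂, hy₂, hB₂sub⟩ := exists_ratBox_subset (hOo.inter (isOpen_ratBox a₁ b₁)) ⟨hy₀O, hy₁⟩
  have h₂₁ : ratBox a₂ b₂ ⊆ ratBox a₁ b₁ := fun x hx => (hB₂sub hx).2
  refine ⟨k, ratBox a₂ b₂, u, F, A, B,
    isOpen_ratBox a₂ b₂, hy₂, fun j => (husa j).mono (h₂₁.trans hV₁) (isSemialgebraic_ratBox a₂ b₂),
    fun j => (huan j).mono (h₂₁.trans hV₁), fun x hx => hFu x (hV₁ (h₂₁ hx)), ?_,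
    fun x hx => ⟨hB₁ x (h₂₁ hx), ?_⟩⟩
  · rw [hpt]
    exact hJ0
  · have := hOsub (hB₂sub hx).1
    simp only [Set.mem_setOf_eq, Pi.sub_apply, sub_eq_zero] at this
    exact this

/-- **Spreading out from `OriginNash d`** (the `ℚ[s₀]`-point data of the slice germ, spread). -/
theorem exists_multiGenData_append_zero {m d : ℕ} (hO : OriginNash d) {s₀ : Fin m → ℝ}
    (hind : AlgebraicIndependent ℚ s₀) {g : (Fin (m + d) → ℝ) → ℝ} {U : Set (Fin (m + d) → ℝ)}
    (hU : IsOpen U) (hy₀ : (Fin.append s₀ (0 : Fin d → ℝ) : Fin (m + d) → ℝ) ∈ U)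
    (hsa : IsSemialgebraicFunOn ℚ U g) (han : AnalyticOnNhd ℝ g U) :
    ∃ k, MultiGenData (m + d) k g (Fin.append s₀ (0 : Fin d → ℝ)) :=
  exists_multiGenData_of_slicePointData hind hU hy₀ hsa han
    (sliceNash_of_originNash hO m s₀ hind g U hU hy₀ hsa han)

/-- Auxiliary step `exists_multiGenData_of_sliceNash`. [bookkeeping] -/
theorem exists_multiGenData_of_sliceNash {m d : ℕ} (hS : SliceNash d) {s₀ : Fin m → ℝ}
    (hind : AlgebraicIndependent ℚ s₀) {g : (Fin (m + d) → ℝ) → ℝ} {U : Set (Fin (m + d) → ℝ)}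
    (hU : IsOpen U) (hy₀ : (Fin.append s₀ (0 : Fin d → ℝ) : Fin (m + d) → ℝ) ∈ U)
    (hsa : IsSemialgebraicFunOn ℚ U g) (han : AnalyticOnNhd ℝ g U) :
    ∃ k, MultiGenData (m + d) k g (Fin.append s₀ (0 : Fin d → ℝ)) :=
  exists_multiGenData_of_slicePointData hind hU hy₀ hsa han (hS m s₀ hind g U hU hy₀ hsa han)

/-- Hence `OriginNash d` gives the GERM form at ordered product points. -/
theorem nashGermMultiGen_append_zero {m d : ℕ} (hO : OriginNash d) {s₀ : Fin m → ℝ}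
    (hind : AlgebraicIndependent ℚ s₀) :
    NashGermMultiGen (m + d) (Fin.append s₀ (0 : Fin d → ℝ)) :=
  fun _ _ hU hy₀ hsa han => exists_multiGenData_append_zero hO hind hU hy₀ hsa han

/-- Piece M at the product points of CODIMENSION `d` (germ form): `m + d = n` generic coordinates
on `range e`, zero elsewhere. -/
def ProductPointMultiGenCodim (n d : ℕ) : Prop :=
  ∀ y₀ : Fin n → ℝ, (∃ (m : ℕ) (e : Fin m → Fin n), m + d = n ∧ Function.Injective e ∧
    AlgebraicIndependent ℚ (y₀ ∘ e) ∧ ∀ j ∉ Set.range e, y₀ j = 0) → NashGermMultiGen n y₀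

end SpreadAssembly
end
end Summit.KontsevichZagierPeriods.RootDecompRationalCubeDichotomy.Rung29430.MultiGen
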